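import Mathlib
import Literature.Computability.Complexity.RangeAvoidance
import Literature.Computability.Complexity.SignDegreeXor
import Summits.PneNP.PneNP.Theorems.PstarIsolation
import Summits.PneNP.PneNP.Theorems.PstarIsolationBound
import Summits.PneNP.PneNP.Theorems.PstarIsolationRobust

/-!
# Isolation of the all-ones range point of a pure `P⋆` local map — the per-vertex form of the promises

FRONTIER range-avoidance ladder, rung F-N3(ψ) (cell `pnp-ideate`, ROUND-19, mechanism M19; restricted-model
algorithmics — nothing here bears on `P` vs `NP`).

The landed promises `PstarIsolationBound.PseudoRandom η κ` and `PstarIsolationRobust.PseudoRandomW η β κ` are stated in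
VOLUME form (one inequality per vertex set `U`).  This file gives the degree-level reading: `degL v` / `degA v` = the
number of XOR / AND slots holding the variable `v`, the additivity `volL(U) = Σ_{v ∈ U} degL v`,
`volA(U) = Σ_{v ∈ U} degA v`, and the implications from PER-VERTEX data (near-regular degrees, resp. total occurrence
`degL v + degA v ≥ (1−η)·4C` and GLOBAL balance `Σ_v |degL v − degA v| ≤ β·√C·n`) plus the discrepancy bounds to the
volume-form promises (`pseudoRandom_of_degrees`, `pseudoRandomW_of_degrees`): the per-vertex promise typed in the
ROUND-19 sketch implies the landed one, so the isolation theorems apply to it verbatim.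
-/

set_option linter.dupNamespace false

open Finset Literature.Computability.Complexity
open Summit.PneNP.PneNP.Theorems.PstarIsolation
open Summit.PneNP.PneNP.Theorems.PstarIsolationBound (PseudoRandom)
open Summit.PneNP.PneNP.Theorems.PstarIsolationRobust (PseudoRandomW)

namespace Summit.PneNP.PneNP.Theorems.PstarIsolationDegrees

variable {n m : ℕ}

/-! ## The per-vertex form of the promises -/

/-- XOR degree of a variable: the number of XOR slots holding it (`volL {v}`). -/
def degL (I : LocalMap 4 n m) (v : Fin n) : ℕ := volL I {v}

/-- AND degree of a variable: the number of AND slots holding it (`volA {v}`). -/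
def degA (I : LocalMap 4 n m) (v : Fin n) : ℕ := volA I {v}

/-- The membership indicator is additive over the vertices of `U`. -/
theorem inU_eq_sum (U : Finset (Fin n)) (w : Fin n) : inU U w = ∑ v ∈ U, inU {v} w := by
  unfold inU
  simp only [Finset.mem_singleton, Finset.sum_ite_eq]

/-- **Additivity of the XOR volume**: `volL(U) = Σ_{v ∈ U} degL v`. -/
theorem volL_eq_sum_degL (I : LocalMap 4 n m) (U : Finset (Fin n)) : volL I U = ∑ v ∈ U, degL I v := by
  unfold degL volL tL
  simp_rw [inU_eq_sum U, ← Finset.sum_add_distrib]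
  exact Finset.sum_comm

/-- **Additivity of the AND volume**: `volA(U) = Σ_{v ∈ U} degA v`. -/
theorem volA_eq_sum_degA (I : LocalMap 4 n m) (U : Finset (Fin n)) : volA I U = ∑ v ∈ U, degA I v := by
  unfold degA volA tA
  simp_rw [inU_eq_sum U, ← Finset.sum_add_distrib]
  exact Finset.sum_comm

/-- **Per-vertex degrees give the promise `PseudoRandom`**: `degL v ≤ (1+η)·2C` and `(1−η)·2C ≤ degA v` for every
variable, together with the discrepancy bounds, imply the (volume-form) promise of `PstarIsolationBound`. -/
theorem pseudoRandom_of_degrees (η κ : ℝ) (I : LocalMap 4 n m)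
    (hL : ∀ v, (degL I v : ℝ) ≤ (1 + η) * (2 * ((m : ℝ) / n)))
    (hA : ∀ v, (1 - η) * (2 * ((m : ℝ) / n)) ≤ (degA I v : ℝ))
    (hdisc : ∀ U : Finset (Fin n),
      (m : ℝ) / n ^ 2 * (U.card : ℝ) ^ 2 - κ * Real.sqrt ((m : ℝ) / n) * U.card ≤ (eL I U : ℝ) ∧
      (eA I U : ℝ) ≤ (m : ℝ) / n ^ 2 * (U.card : ℝ) ^ 2 + κ * Real.sqrt ((m : ℝ) / n) * U.card ∧
      (eLA I U : ℝ) ≤ 4 * ((m : ℝ) / n ^ 2 * (U.card : ℝ) ^ 2) + 2 * κ * Real.sqrt ((m : ℝ) / n) * U.card) :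
    PseudoRandom η κ I := by
  intro U
  obtain ⟨h1, h2, h3⟩ := hdisc U
  refine ⟨?_, ?_, h1, h2, h3⟩
  · rw [volL_eq_sum_degL]; push_cast
    calc ∑ v ∈ U, (degL I v : ℝ) ≤ ∑ v ∈ U, (1 + η) * (2 * ((m : ℝ) / n)) := Finset.sum_le_sum fun v _ => hL v
      _ = (1 + η) * (2 * ((m : ℝ) / n)) * U.card := by rw [Finset.sum_const, nsmul_eq_mul]; ring
  · rw [volA_eq_sum_degA]; push_cast
    calc (1 - η) * (2 * ((m : ℝ) / n)) * U.card = ∑ v ∈ U, (1 - η) * (2 * ((m : ℝ) / n)) := by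
          rw [Finset.sum_const, nsmul_eq_mul]; ring
      _ ≤ ∑ v ∈ U, (degA I v : ℝ) := Finset.sum_le_sum fun v _ => hA v

/-- **Per-vertex data give the robust promise `PseudoRandomW`** (the SketchR19 form implies the landed volume
form): total occurrence `(1−η)·4C ≤ degL v + degA v` for every variable, GLOBAL balance
`Σ_v |degL v − degA v| ≤ β·√C·n`, and the discrepancy bounds. -/
theorem pseudoRandomW_of_degrees (η β κ : ℝ) (I : LocalMap 4 n m)
    (hocc : ∀ v, (1 - η) * (4 * ((m : ℝ) / n)) ≤ (degL I v : ℝ) + degA I v)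
    (hbal : ∑ v, |(degL I v : ℝ) - degA I v| ≤ β * Real.sqrt ((m : ℝ) / n) * n)
    (hdisc : ∀ U : Finset (Fin n),
      (m : ℝ) / n ^ 2 * (U.card : ℝ) ^ 2 - κ * Real.sqrt ((m : ℝ) / n) * U.card ≤ (eL I U : ℝ) ∧
      (eL I U : ℝ) ≤ (m : ℝ) / n ^ 2 * (U.card : ℝ) ^ 2 + κ * Real.sqrt ((m : ℝ) / n) * U.card ∧
      (eA I U : ℝ) ≤ (m : ℝ) / n ^ 2 * (U.card : ℝ) ^ 2 + κ * Real.sqrt ((m : ℝ) / n) * U.card ∧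
      (eLA I U : ℝ) ≤ 4 * ((m : ℝ) / n ^ 2 * (U.card : ℝ) ^ 2) + 2 * κ * Real.sqrt ((m : ℝ) / n) * U.card) :
    PseudoRandomW η β κ I := by
  intro U
  obtain ⟨h1, h2, h3, h4⟩ := hdisc U
  refine ⟨?_, ?_, h1, h2, h3, h4⟩
  · have hsum : (volL I U : ℝ) + volA I U = ∑ v ∈ U, ((degL I v : ℝ) + degA I v) := by
      rw [volL_eq_sum_degL, volA_eq_sum_degA]; push_cast
      rw [← Finset.sum_add_distrib]
    rw [hsum]
    calc (1 - η) * (4 * ((m : ℝ) / n)) * U.card = ∑ v ∈ U, (1 - η) * (4 * ((m : ℝ) / n)) := by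
          rw [Finset.sum_const, nsmul_eq_mul]; ring
      _ ≤ ∑ v ∈ U, ((degL I v : ℝ) + degA I v) := Finset.sum_le_sum fun v _ => hocc v
  · have hsum : (volL I U : ℝ) - volA I U = ∑ v ∈ U, ((degL I v : ℝ) - degA I v) := by
      rw [volL_eq_sum_degL, volA_eq_sum_degA]; push_cast
      rw [← Finset.sum_sub_distrib]
    rw [hsum]
    calc ∑ v ∈ U, ((degL I v : ℝ) - degA I v) ≤ ∑ v ∈ U, |(degL I v : ℝ) - degA I v| :=
          Finset.sum_le_sum fun v _ => le_abs_self _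
      _ ≤ ∑ v, |(degL I v : ℝ) - degA I v| :=
          Finset.sum_le_sum_of_subset_of_nonneg (Finset.subset_univ U) fun v _ _ => abs_nonneg _
      _ ≤ β * Real.sqrt ((m : ℝ) / n) * n := hbal

end Summit.PneNP.PneNP.Theorems.PstarIsolationDegrees
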